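import Mathlib.Combinatorics.Nullstellensatz
import Mathlib.Data.Finsupp.Encodable
import Mathlib.Data.Nat.Find
import Literature.Barriers.PneNP.Algebrization
import Literature.Computability.Complexity.PolyTimeCountable
import Literature.Computability.Complexity.MultiquadraticExtension
import HarnessLib

/-!
# Aaronson–Wigderson Thm. 5.6: the forcing construction (one stage)

Infrastructure for the proof of `Literature.Barriers.PneNP.Algebrization_npLinearSize`
(`Literature/Barriers/PneNP/Algebrization.lean`; S. Aaronson, A. Wigderson, *Algebrization: a new
barrier in complexity theory*, STOC 2008, full version Thm. 5.6, pp. 26–27: "There exist `A, Ã`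
such that `NTIME^Ã(2ⁿ) ⊂ SIZE^A(n)`"), in the tree's transcript model of oracle computation
(`OracleAlg`, `PRel`, `NPRel`, `ExtensionOracle.toOracle`). This file provides ONE STAGE of the
construction, entirely proved:

* `AW56.Point`, `AW56.val`, `AW56.queryPt`, `AW56.toOracle_congr`, `AW56.run_congr_of_runPts`:
  the points `(m, p, y ∈ 𝔽_pᵐ)` of an extension oracle, the point reached by a query string, and
  "runs depend only on the answers to the queries asked" (Arora–Barak 2009, §3.4) for extension
  oracles: two extension oracles agreeing on the `≤ k` points reached by a `k`-round run give the
  same run.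
* `AW56.NPIdx`, `AW56.Acc`, `AW56.budget`, `AW56.Acc.local`, `AW56.exists_idx_of_mem_NPRel`,
  `AW56.exists_enum`: an `NP^O` language is `{x | ∃ w, |w| ≤ p(|x|), M^O accepts ⟨x, w⟩ within
  q(|⟨x,w⟩|) rounds}` for a polynomial-time step function `M` and polynomials `p, q`; acceptance
  is witnessed by `≤ budget = q(2|x| + 2 + p(|x|))` points; the admissible triples `(M, p, q)` are
  enumerated by `ℕ` (AW p. 26: "Let `M₁, M₂, …` be an enumeration of … oracle machines";
  `countable_setOf_isPolyTime`).
* `AW56.World` (a Boolean oracle given by its slices together with a multiquadratic extension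
  over every prime field — the *consistency witness* of AW's "fixed consistently"), `AW56.Agrees`,
  `AW56.Forces` ("by consistently fixing … points, we can force `Mᵢ` to accept on input `x`"),
  `AW56.Pairs` (the machine/input pairs `⟨i, x⟩` handled at arity `ℓ = 8s`: `i < s`, `|x| = s`,
  query budget `≤ 2ˢ`), `AW56.Valid`/`AW56.Terminal`/`AW56.exists_terminal` (the iterative
  process halts: a valid configuration with the most satisfied pairs admits no further step),
  `AW56.code`, `AW56.bxor` (the strings `w_{i,x}` and `z ⊕ w_{i,x}`), and the stage theorem
  `AW56.exists_stage`: from a world `W₀` and constraint points `Y₀` one obtains the halting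
  configuration `(Y, W_T, Sat)` of the forcing process at arity `ℓ`, a string `z`, and a new world
  `W` agreeing with `W_T` off arity `ℓ` and on `Y`, whose Boolean slice at arity `ℓ` satisfies
  `A_ℓ(z ⊕ w_{i,x}) = [⟨i, x⟩ ∈ Sat]` (AW p. 26: Lemma 4.5, the union bound for `z'`, "We will
  choose the Boolean function `f` so that … `f(z' ⊕ w_{i,x})` encodes whether or not `Mᵢ`
  accepts").

The limit over all arities, the correctness of the coding and the linear-size oracle circuits
are in `Literature/Barriers/PneNP/AlgebrizationProofs.lean`.

* Barrier audit 2026-08-16 (last section, `AW56.not_exists_free_degreeOne` and its lemmas): the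
  forcing lemma is MULTIQUADRATIC and cannot be made multilinear — over every odd prime field one
  query to a multilinear extension at `(½, …, ½)` returns `½ⁿ · |f⁻¹(1)|` (AW §1.4 p. 7, after
  Juma–Kabanets–Rackoff–Shpilka), so toggling any single Boolean point is detected and the
  statement of `Multiquadratic.exists_free` (AW Lemma 4.5) with multidegree `1` in place of `2` is
  FALSE (AW p. 19: "multidegree 2 is essential here"). Scope consequence for the barrier entry
  `Algebrization_npLinearSize` (`IsExtensionOf A 2`): the tree's (and AW's) world for the
  `NP`-circuit line is a degree-2 world; its degree-1 analogue over the prime fields is not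
  obtained by this construction (AW §1.3 p. 6), in characteristic 2 it is Aydınlıoğlu–Bach's
  Thm. 35 (affine = multilinear extensions over `GF(2ᵏ)`, polynomial size).

## References

* S. Aaronson, A. Wigderson, *Algebrization: a new barrier in complexity theory*, STOC 2008 (full
  version), Thm. 5.6 (pp. 26–27), Lemma 4.5 (pp. 19–20), §1.3 p. 6, §1.4 p. 7, Thm. 4.4 and the
  remark after it (p. 19), Thm. 5.11 (pp. 27–28), §11 footnote 17 (p. 47) [AaronsonWigderson2008].
* B. Aydınlıoğlu, E. Bach, *Affine relativization: unifying the algebrization and relativization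
  barriers*, ACM TOCT 10 (2018) (read in ECCC TR16-040): Summary of Results (p. 3), §4.1
  Lemma 33, Thm. 34, Thm. 35 (pp. 27–30) [AydinliogluBach2018].
* S. Arora, B. Barak, *Computational Complexity: A Modern Approach*, CUP 2009, §3.4 (oracle
  machines; runs are determined by the answers) [AroraBarak2009].
-/

namespace Literature.Barriers.PneNP

namespace AW56

open _root_.Computability Literature.Computability.Complexity Literature.Computability.Complexity.Multiquadratic MvPolynomial Finset

/-! ### Points of an extension oracle and the queries reaching them -/

/-- A point of arity `m`: a prime `p` and coordinates `y ∈ 𝔽_pᵐ`. [cite: AaronsonWigderson2008, Def. 2.2] -/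
abbrev APoint (m : ℕ) : Type := Σ p : Nat.Primes, (Fin m → ZMod p)

/-- A point of an extension oracle: an arity `m` and a point of `𝔽_pᵐ` for some prime `p`
(the arity first, so that the points of one arity form a `Finset.preimage (Sigma.mk m)`).
[cite: AaronsonWigderson2008, Def. 2.2] -/
abbrev Point : Type := Σ m : ℕ, APoint m

/-- The value `Ã_{m,𝔽_p}(y)` of the extension oracle `E` at the point `(m, p, y)`.
[cite: AaronsonWigderson2008, Def. 2.2] -/
noncomputable def val (E : ExtensionOracle) (pt : Point) : ZMod (pt.2.1 : ℕ) :=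
  eval pt.2.2 (E.poly pt.2.1 pt.1)

/-- The point reached by the query string `y`: `none` for a malformed query or a non-prime
modulus (answered `[]` by every extension oracle), otherwise `(m, p, x mod p)` for the decoded
query `(p, m, x)`. [cite: AaronsonWigderson2008, Def. 2.2] -/
def queryPt (y : List Bool) : Option Point :=
  match encodingExtQuery.decode y with
  | none => none
  | some ⟨p, m, x⟩ => if hp : p.Prime then some ⟨m, ⟨p, hp⟩, fun i => (x i : ZMod p)⟩ else none

/-- Two extension oracles agreeing at the point reached by a query answer it identically.
[cite: AaronsonWigderson2008, Def. 2.2] -/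
theorem toOracle_congr (E E' : ExtensionOracle) (y : List Bool)
    (h : ∀ pt, queryPt y = some pt → val E' pt = val E pt) : E'.toOracle y = E.toOracle y := by
  unfold ExtensionOracle.toOracle
  cases hd : encodingExtQuery.decode y with
  | none => rfl
  | some t =>
    obtain ⟨p, m, x⟩ := t
    dsimp only
    by_cases hp : p.Prime
    · have hq : queryPt y = some ⟨m, ⟨p, hp⟩, fun i => (x i : ZMod p)⟩ := by
        simp [queryPt, hd, hp]
      have := h _ hq
      simp only [val] at this
      simp only [ExtensionOracle.answer, hp, ↓reduceDIte]
      rw [this]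
    · simp [ExtensionOracle.answer, hp]

/-- Runs and transcripts depend only on the oracle's answers to the queries asked (induction on
the fuel; Arora–Barak 2009, §3.4; the same lemma is proved as
`Literature.Computability.QuantumComplexity.runAux_queriesAux_congr` in `OracleSeparationBQPPH.lean`, not imported
here). [cite: AroraBarak2009, §3.4] -/
theorem runAux_queriesAux_congr {β : Type} (M : OracleAlg β) {O O' : Oracle} (x : List Bool) :
    ∀ (k : ℕ) (ans : List (List Bool)), (∀ y ∈ M.queriesAux O x k ans, O' y = O y) →
      M.runAux O' x k ans = M.runAux O x k ans ∧
        M.queriesAux O' x k ans = M.queriesAux O x k ans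
  | 0, _, _ => ⟨rfl, rfl⟩
  | k + 1, ans, h => by
    unfold OracleAlg.runAux OracleAlg.queriesAux
    unfold OracleAlg.queriesAux at h
    cases hs : M.step x ans with
    | inr b => simp
    | inl qy =>
      simp only [hs, List.mem_cons, forall_eq_or_imp] at h
      obtain ⟨hq, hrest⟩ := h
      simp only [hq]
      obtain ⟨h1, h2⟩ := runAux_queriesAux_congr M x k (ans ++ [O qy]) hrest
      exact ⟨h1, by rw [h2]⟩

/-- The (finitely many) points reached by the run of `M` with the extension oracle `E` on input
`x` within `k` rounds. [cite: AaronsonWigderson2008, Thm. 5.6 (proof: "the set of inactive points")] -/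
noncomputable def runPts (E : ExtensionOracle) (M : OracleAlg Bool) (k : ℕ) (x : List Bool) :
    Finset Point :=
  ((M.queries E.toOracle k x).filterMap queryPt).toFinset

/-- A `k`-round run reaches at most `k` points. [cite: AroraBarak2009, §3.4] -/
theorem card_runPts_le (E : ExtensionOracle) (M : OracleAlg Bool) (k : ℕ) (x : List Bool) :
    (runPts E M k x).card ≤ k :=
  (List.toFinset_card_le _).trans
    ((List.length_filterMap_le _ _).trans (M.length_queries_le _ k x))

/-- Two extension oracles agreeing on the points reached by a run give the same run.
[cite: AroraBarak2009, §3.4] -/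
theorem run_congr_of_runPts {E E' : ExtensionOracle} {M : OracleAlg Bool} {k : ℕ} {x : List Bool}
    (h : ∀ pt ∈ runPts E M k x, val E' pt = val E pt) :
    M.run E'.toOracle k x = M.run E.toOracle k x :=
  (runAux_queriesAux_congr M x k [] fun y hy => toOracle_congr E E' y fun pt hpt =>
    h pt (by
      simp only [runPts, List.mem_toFinset, List.mem_filterMap]
      exact ⟨y, hy, hpt⟩)).1

/-! ### Nondeterministic polynomial-time oracle machines as data -/

/-- The data of an `NP^O` language in the transcript model: a step function `M` (the `P^O`
verifier), the certificate-length polynomial `p` and the round polynomial `q`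
(`NPRel O = polyExists (PRel O)`). [cite: AaronsonWigderson2008, Thm. 5.6 (proof: "an enumeration of … oracle machines")] -/
structure NPIdx where
  /-- the verifier's step function -/
  M : OracleAlg Bool
  /-- certificate length bound -/
  p : Polynomial ℕ
  /-- round (time) bound of the verifier -/
  q : Polynomial ℕ

/-- `Acc O i x`: the nondeterministic machine `i = (M, p, q)` accepts `x` relative to `O` — some
certificate `w`, `|w| ≤ p(|x|)`, makes `M^O` output `true` on `⟨x, w⟩` within `q(|⟨x, w⟩|)`
rounds. [cite: AaronsonWigderson2008, Thm. 5.6 (proof)] -/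
def Acc (O : Oracle) (i : NPIdx) (x : List Bool) : Prop :=
  ∃ w : List Bool, w.length ≤ i.p.eval x.length ∧
    i.M.run O (i.q.eval (boolPair x w).length) (boolPair x w) = some true

/-- The query budget of machine `i` on inputs of length `n`: `q(2n + 2 + p(n))` bounds the number
of rounds, hence of queries, of every accepting run (`|⟨x, w⟩| = 2|x| + 2 + |w|`).
[cite: AaronsonWigderson2008, Thm. 5.6 (proof: "fixing at most 2ⁿ active points")] -/
noncomputable def budget (i : NPIdx) (n : ℕ) : ℕ :=
  i.q.eval (2 * n + 2 + i.p.eval n)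

/-- Polynomials over `ℕ` are monotone (same statement as `Literature.Computability.Complexity.natPoly_eval_mono` of
`CircuitLowerBounds.lean`, restated to keep that file's analytic imports out of the barrier
catalogue). [folklore] -/
theorem natPoly_eval_mono (p : Polynomial ℕ) {a b : ℕ} (h : a ≤ b) : p.eval a ≤ p.eval b := by
  rw [Polynomial.eval_eq_sum_range, Polynomial.eval_eq_sum_range]
  exact Finset.sum_le_sum fun i _ => Nat.mul_le_mul_left _ (Nat.pow_le_pow_left h i)

/-- **Locality of acceptance.** An accepting computation of `i` on `x` relative to `Ã = E` is
witnessed by at most `budget i |x|` points of `E`: every extension oracle agreeing with `E` there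
accepts `x` as well (with the same certificate and the same run).
[cite: AaronsonWigderson2008, Thm. 5.6 (proof)] [cite: AroraBarak2009, §3.4] -/
theorem Acc.local {E : ExtensionOracle} {i : NPIdx} {x : List Bool} (h : Acc E.toOracle i x) :
    ∃ Y : Finset Point, Y.card ≤ budget i x.length ∧
      ∀ E' : ExtensionOracle, (∀ pt ∈ Y, val E' pt = val E pt) → Acc E'.toOracle i x := by
  obtain ⟨w, hw, hrun⟩ := h
  refine ⟨runPts E i.M (i.q.eval (boolPair x w).length) (boolPair x w), ?_, fun E' hE' => ?_⟩
  · refine (card_runPts_le _ _ _ _).trans (natPoly_eval_mono _ ?_)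
    rw [length_boolPair]
    omega
  · exact ⟨w, hw, by rw [run_congr_of_runPts hE', hrun]⟩

/-- Every `NP^O` language is `{x | Acc O i x}` for some `i = (M, p, q)` with `M` polynomial-time
(unfolding `NPRel O = polyExists (PRel O)`). [cite: AaronsonWigderson2008, Thm. 5.6 (proof)] -/
theorem exists_idx_of_mem_NPRel {O : Oracle} {L : Language Bool} (hL : L ∈ NPRel O) :
    ∃ i : NPIdx, i.M.IsPolyTime encodingBoolBool ∧ ∀ x, x ∈ L ↔ Acc O i x := by
  obtain ⟨L', ⟨M, hM, q, hq⟩, p, hp⟩ := hL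
  refine ⟨⟨M, p, q⟩, hM, fun x => ?_⟩
  rw [hp x]
  refine exists_congr fun w => and_congr_right fun _ => ?_
  rw [(hq (boolPair x w)).1, Option.some.injEq]
  exact Set.mem_iff_boolIndicator _ (boolPair x w)

/-- Polynomials over `ℕ` form a countable type (coefficients are finitely supported; same
statement as `Literature.Computability.QuantumComplexity.countable_polynomial_nat` of the quantum-complexity file
`OracleSeparationBQPPH.lean`, not imported here). [folklore] -/
theorem countable_natPoly : Countable (Polynomial ℕ) :=
  (AddMonoidAlgebra.coeff_injective.comp Polynomial.toFinsupp_injective).countable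

/-- **Enumeration of the machines** (AW p. 26: "Let `M₁, M₂, …` be an enumeration of … oracle
machines"): a sequence `e : ℕ → NPIdx` containing every triple `(M, p, q)` with `M`
polynomial-time (`countable_setOf_isPolyTime`; the other terms of the sequence are arbitrary).
[cite: AaronsonWigderson2008, Thm. 5.6 (proof)] [cite: AroraBarak2009, §1.4] -/
theorem exists_enum : ∃ e : ℕ → NPIdx, ∀ i : NPIdx, i.M.IsPolyTime encodingBoolBool → ∃ k, e k = i := by
  classical
  haveI := countable_natPoly
  let S : Set NPIdx := {i : NPIdx | i.M.IsPolyTime encodingBoolBool}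
  have hS : S.Countable := by
    have h1 := (countable_setOf_isPolyTime encodingBoolBool).prod
      ((Set.countable_univ (α := Polynomial ℕ)).prod (Set.countable_univ (α := Polynomial ℕ)))
    refine (h1.image fun t => (⟨t.1, t.2.1, t.2.2⟩ : NPIdx)).mono ?_
    rintro ⟨M, p, q⟩ hM
    exact ⟨⟨M, p, q⟩, ⟨hM, Set.mem_univ _, Set.mem_univ _⟩, rfl⟩
  obtain ⟨g, hg⟩ := Set.countable_iff_exists_injective.1 hS
  let dflt : NPIdx := ⟨OracleAlg.ofFun fun _ => true, 0, 0⟩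
  refine ⟨fun k => if h : ∃ s : S, g s = k then (h.choose : NPIdx) else dflt, fun i hi => ?_⟩
  have hiS : i ∈ S := hi
  refine ⟨g ⟨i, hiS⟩, ?_⟩
  have h : ∃ s : S, g s = g ⟨i, hiS⟩ := ⟨⟨i, hiS⟩, rfl⟩
  show (if h : ∃ s : S, g s = g ⟨i, hiS⟩ then (h.choose : NPIdx) else dflt) = i
  rw [dif_pos h, show h.choose = ⟨i, hiS⟩ from hg h.choose_spec]

/-! ### Worlds and agreement -/

/-- A **world**: a Boolean oracle `A` given by its slices `A_m : {0,1}ᵐ → {0,1}` together with a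
multiquadratic extension `E` of it over every prime field (`IsMQExt`, i.e. `E.IsExtensionOf A 2`
slice by slice). In the forcing process a world is the witness that the points fixed so far are
"fixed consistently" (AW p. 26). [cite: AaronsonWigderson2008, Thm. 5.6 (proof) and Def. 2.2] -/
structure World where
  /-- the Boolean slices -/
  A : ∀ m : ℕ, (Fin m → Bool) → Bool
  /-- the extension polynomials -/
  E : ExtensionOracle
  /-- each polynomial is a multiquadratic extension of the corresponding slice -/
  ok : ∀ (p : Nat.Primes) (m : ℕ), IsMQExt (E.poly p m) (A m)

/-- The empty world: `A = ∅`, all polynomials `0`. [cite: AaronsonWigderson2008, Def. 2.2] -/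
noncomputable def World.empty : World where
  A _ _ := false
  E := ⟨fun _ _ => 0⟩
  ok p m := ⟨fun i => by simp [degreeOf_zero], fun w => by simp⟩

/-- Replacing the slice and the polynomials of a world at one arity `ℓ`.
[cite: AaronsonWigderson2008, Thm. 5.6 (proof: "At stage n … our goal is to fix Ã_{n,F}")] -/
noncomputable def World.update (W : World) (ℓ : ℕ) (f : (Fin ℓ → Bool) → Bool)
    (P : ∀ p : Nat.Primes, MvPolynomial (Fin ℓ) (ZMod p)) (hP : ∀ p, IsMQExt (P p) f) : World where
  A m := if h : m = ℓ then h ▸ f else W.A m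
  E := ⟨fun p m => if h : m = ℓ then h ▸ P p else W.E.poly p m⟩
  ok p m := by
    by_cases h : m = ℓ
    · subst h
      simpa using hP p
    · simpa [h] using W.ok p m

/-- The updated world has the new slice at arity `ℓ`. [folklore] -/
@[simp] theorem World.update_A_self (W : World) (ℓ : ℕ) (f : (Fin ℓ → Bool) → Bool)
    (P : ∀ p : Nat.Primes, MvPolynomial (Fin ℓ) (ZMod p)) (hP : ∀ p, IsMQExt (P p) f) :
    (W.update ℓ f P hP).A ℓ = f := by
  simp [World.update]

/-- The updated world is unchanged at other arities. [folklore] -/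
theorem World.update_A_ne (W : World) (ℓ : ℕ) (f : (Fin ℓ → Bool) → Bool)
    (P : ∀ p : Nat.Primes, MvPolynomial (Fin ℓ) (ZMod p)) (hP : ∀ p, IsMQExt (P p) f) {m : ℕ}
    (h : m ≠ ℓ) : (W.update ℓ f P hP).A m = W.A m := by
  simp [World.update, h]

/-- The updated world has the new polynomials at arity `ℓ`. [folklore] -/
@[simp] theorem World.update_poly_self (W : World) (ℓ : ℕ) (f : (Fin ℓ → Bool) → Bool)
    (P : ∀ p : Nat.Primes, MvPolynomial (Fin ℓ) (ZMod p)) (hP : ∀ p, IsMQExt (P p) f)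
    (p : Nat.Primes) : (W.update ℓ f P hP).E.poly p ℓ = P p := by
  simp [World.update]

/-- The updated world has the old polynomials at other arities. [folklore] -/
theorem World.update_poly_ne (W : World) (ℓ : ℕ) (f : (Fin ℓ → Bool) → Bool)
    (P : ∀ p : Nat.Primes, MvPolynomial (Fin ℓ) (ZMod p)) (hP : ∀ p, IsMQExt (P p) f)
    (p : Nat.Primes) {m : ℕ} (h : m ≠ ℓ) : (W.update ℓ f P hP).E.poly p m = W.E.poly p m := by
  simp [World.update, h]

/-- `Agrees ℓ Y E E'`: the extension oracle `E'` has the same polynomials as `E` at all arities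
`< ℓ` (the slices already fixed) and the same values at the points of `Y` (the points fixed so
far). [cite: AaronsonWigderson2008, Thm. 5.6 (proof: inactive points never change)] -/
def Agrees (ℓ : ℕ) (Y : Finset Point) (E E' : ExtensionOracle) : Prop :=
  (∀ (p : Nat.Primes) (m : ℕ), m < ℓ → E'.poly p m = E.poly p m) ∧ ∀ pt ∈ Y, val E' pt = val E pt

/-- `Agrees` is reflexive. [folklore] -/
theorem Agrees.rfl {ℓ : ℕ} {Y : Finset Point} {E : ExtensionOracle} : Agrees ℓ Y E E :=
  ⟨fun _ _ _ => Eq.refl _, fun _ _ => Eq.refl _⟩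

/-- `Agrees` is transitive (the second point set containing the first). [folklore] -/
theorem Agrees.trans {ℓ : ℕ} {Y Y' : Finset Point} {E₁ E₂ E₃ : ExtensionOracle}
    (h₁ : Agrees ℓ Y E₁ E₂) (h₂ : Agrees ℓ Y' E₂ E₃) (hY : Y ⊆ Y') : Agrees ℓ Y E₁ E₃ :=
  ⟨fun p m hm => (h₂.1 p m hm).trans (h₁.1 p m hm),
    fun pt hpt => (h₂.2 pt (hY hpt)).trans (h₁.2 pt hpt)⟩

/-- `Agrees` is antitone in the point set. [folklore] -/
theorem Agrees.mono {ℓ : ℕ} {Y Y' : Finset Point} {E E' : ExtensionOracle}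
    (h : Agrees ℓ Y' E E') (hY : Y ⊆ Y') : Agrees ℓ Y E E' :=
  ⟨h.1, fun pt hpt => h.2 pt (hY hpt)⟩

/-! ### The pairs handled at one arity, forcing, configurations -/

/-- The coding arity of input length `s` is `ℓ = 8s`; conversely `s = ℓ / 8`. At arity `ℓ`
divisible by `8` the construction handles the machine/input pairs `⟨i, x⟩` with `i < s`,
`x ∈ {0,1}ˢ` whose query budget at length `s` is at most `2ˢ` (AW handle `i ≤ n`, `x ∈ {0,1}ⁿ`
at arity `4n`, all machines being clocked `NTIME(2ⁿ)` machines; here the clock is the budget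
condition, met by every fixed machine at all large `s`); other arities carry no pairs.
[cite: AaronsonWigderson2008, Thm. 5.6 (proof: "n2ⁿ pairs of the form ⟨i, x⟩")] -/
noncomputable def Pairs (e : ℕ → NPIdx) (ℓ : ℕ) : Finset (ℕ × List Bool) :=
  if 8 ∣ ℓ then
    ((range (ℓ / 8)) ×ˢ ((univ : Finset (Fin (ℓ / 8) → Bool)).image List.ofFn)).filter
      fun pr => budget (e pr.1) (ℓ / 8) ≤ 2 ^ (ℓ / 8)
  else ∅

/-- Membership in `Pairs`. [cite: AaronsonWigderson2008, Thm. 5.6 (proof)] -/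
theorem mem_Pairs_iff (e : ℕ → NPIdx) (ℓ : ℕ) (pr : ℕ × List Bool) :
    pr ∈ Pairs e ℓ ↔ 8 ∣ ℓ ∧ pr.1 < ℓ / 8 ∧ pr.2.length = ℓ / 8 ∧
      budget (e pr.1) (ℓ / 8) ≤ 2 ^ (ℓ / 8) := by
  unfold Pairs
  split_ifs with h8
  · simp only [mem_filter, mem_product, mem_range, mem_image, mem_univ, true_and, h8]
    constructor
    · rintro ⟨⟨hi, v, hv⟩, hb⟩
      exact ⟨hi, by rw [← hv, List.length_ofFn], hb⟩
    · rintro ⟨hi, hlen, hb⟩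
      refine ⟨⟨hi, fun j => pr.2[(j : ℕ)]'(by omega), ?_⟩, hb⟩
      exact List.ext_getElem (by simp [hlen]) fun n h₁ h₂ => by
        simp only [List.getElem_ofFn]
  · simp [h8]

/-- There are at most `s · 2ˢ` pairs at arity `ℓ`, `s = ℓ / 8`. [cite: AaronsonWigderson2008, Thm. 5.6 (proof)] -/
theorem card_Pairs_le (e : ℕ → NPIdx) (ℓ : ℕ) : (Pairs e ℓ).card ≤ (ℓ / 8) * 2 ^ (ℓ / 8) := by
  unfold Pairs
  split_ifs with h8
  · refine (card_filter_le _ _).trans ?_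
    rw [card_product, card_range]
    exact Nat.mul_le_mul_left _ (card_image_le.trans (by simp))
  · simp

/-- `Forces e ℓ Y E ⟨i, x⟩`: every extension oracle agreeing with `E` below arity `ℓ` and on
the points `Y` makes the machine `e i` accept `x` — AW's "we can force `Mᵢ` to accept on input
`x`" by the values fixed at `Y`. [cite: AaronsonWigderson2008, Thm. 5.6 (proof)] -/
def Forces (e : ℕ → NPIdx) (ℓ : ℕ) (Y : Finset Point) (E : ExtensionOracle)
    (pr : ℕ × List Bool) : Prop :=
  ∀ E' : ExtensionOracle, Agrees ℓ Y E E' → Acc E'.toOracle (e pr.1) pr.2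

/-- Forcing persists when more points are fixed (consistently with the old ones).
[cite: AaronsonWigderson2008, Thm. 5.6 (proof: "p(y) never again changes")] -/
theorem Forces.mono {e : ℕ → NPIdx} {ℓ : ℕ} {Y Y' : Finset Point} {E E' : ExtensionOracle}
    {pr : ℕ × List Bool} (h : Forces e ℓ Y E pr) (hY : Y ⊆ Y') (hE : Agrees ℓ Y E E') :
    Forces e ℓ Y' E' pr :=
  fun E'' h'' => h E'' (hE.trans h'' hY)

/-- A configuration of the iterative process at one arity: the points fixed so far (`Y`), a
world witnessing that they are fixed consistently (`W`), and the satisfied pairs (`Sat`).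
[cite: AaronsonWigderson2008, Thm. 5.6 (proof)] -/
structure Config where
  /-- the inactive (fixed) points -/
  Y : Finset Point
  /-- the consistency witness -/
  W : World
  /-- the satisfied pairs -/
  Sat : Finset (ℕ × List Bool)

/-- Valid configurations reachable from `(Y₀, W₀)` at arity `ℓ`: the old points are kept and
respected, arities `< ℓ` are untouched, every satisfied pair is a handled pair and is forced, and
at most `2ˢ` points were fixed per satisfied pair. [cite: AaronsonWigderson2008, Thm. 5.6 (proof)] -/
def Valid (e : ℕ → NPIdx) (ℓ : ℕ) (Y₀ : Finset Point) (W₀ : World) (c : Config) : Prop :=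
  Y₀ ⊆ c.Y ∧ Agrees ℓ Y₀ W₀.E c.W.E ∧ c.Sat ⊆ Pairs e ℓ ∧
    c.Y.card ≤ Y₀.card + c.Sat.card * 2 ^ (ℓ / 8) ∧ ∀ pr ∈ c.Sat, Forces e ℓ c.Y c.W.E pr

/-- Halting configurations: no unsatisfied handled pair can be forced by consistently fixing at
most `2ˢ` further points ("We stop only when we can no longer find another `⟨i, x⟩` to
satisfy"). [cite: AaronsonWigderson2008, Thm. 5.6 (proof)] -/
def Terminal (e : ℕ → NPIdx) (ℓ : ℕ) (c : Config) : Prop :=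
  ∀ pr ∈ Pairs e ℓ, pr ∉ c.Sat → ∀ (Y' : Finset Point) (W' : World), c.Y ⊆ Y' →
    Y'.card ≤ c.Y.card + 2 ^ (ℓ / 8) → Agrees ℓ c.Y c.W.E W'.E → ¬ Forces e ℓ Y' W'.E pr

/-- **The iterative process halts**: there is a valid halting configuration (a valid
configuration with the largest number of satisfied pairs). [cite: AaronsonWigderson2008, Thm. 5.6 (proof)] -/
theorem exists_terminal (e : ℕ → NPIdx) (ℓ : ℕ) (Y₀ : Finset Point) (W₀ : World) :
    ∃ c : Config, Valid e ℓ Y₀ W₀ c ∧ Terminal e ℓ c := by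
  classical
  let P : ℕ → Prop := fun k => ∃ c : Config, Valid e ℓ Y₀ W₀ c ∧ c.Sat.card = k
  have hP0 : P 0 := ⟨⟨Y₀, W₀, ∅⟩, ⟨Subset.rfl, Agrees.rfl, empty_subset _, by simp, by simp⟩, rfl⟩
  obtain ⟨c, hc, hk⟩ : P (Nat.findGreatest P (Pairs e ℓ).card) :=
    Nat.findGreatest_spec (Nat.zero_le _) hP0
  refine ⟨c, hc, fun pr hpr hnot Y' W' hYY' hcard hag hforce => ?_⟩
  obtain ⟨h₀, hag₀, hsat, hcard₀, hfor⟩ := hc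
  -- one more step gives a valid configuration with one more satisfied pair
  have hP' : P (c.Sat.card + 1) := by
    refine ⟨⟨Y', W', insert pr c.Sat⟩, ⟨h₀.trans hYY', hag₀.trans hag h₀,
      insert_subset hpr hsat, ?_, ?_⟩, by rw [card_insert_of_notMem hnot]⟩
    · rw [card_insert_of_notMem hnot]
      calc Y'.card ≤ c.Y.card + 2 ^ (ℓ / 8) := hcard
        _ ≤ Y₀.card + c.Sat.card * 2 ^ (ℓ / 8) + 2 ^ (ℓ / 8) := Nat.add_le_add_right hcard₀ _
        _ = Y₀.card + (c.Sat.card + 1) * 2 ^ (ℓ / 8) := by ring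
    · intro pr' hpr'
      rcases mem_insert.1 hpr' with rfl | hpr'
      · exact hforce
      · exact (hfor pr' hpr').mono hYY' hag
  have hle : c.Sat.card + 1 ≤ (Pairs e ℓ).card := by
    have := card_le_card (insert_subset hpr hsat)
    rwa [card_insert_of_notMem hnot] at this
  exact Nat.findGreatest_is_greatest (by rw [← hk]; exact Nat.lt_succ_self _) hle hP'

/-! ### Coding strings -/

/-- The string `w_{i,x} ∈ {0,1}^ℓ` of the pair `⟨i, x⟩`: `x`, then a single `1` at position
`|x| + i`, zeros elsewhere ("associate a unique string `w_{i,x}` … in some arbitrary way").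
[cite: AaronsonWigderson2008, Thm. 5.6 (proof)] -/
def code (ℓ : ℕ) (pr : ℕ × List Bool) : Fin ℓ → Bool := fun j =>
  if h : (j : ℕ) < pr.2.length then pr.2[(j : ℕ)] else decide ((j : ℕ) = pr.2.length + pr.1)

/-- Bitwise exclusive or of two strings (`z ⊕ w`). [cite: AaronsonWigderson2008, Thm. 5.6 (proof)] -/
def bxor {ℓ : ℕ} (z c : Fin ℓ → Bool) : Fin ℓ → Bool := fun j => xor (z j) (c j)

/-- `(b ⊕ c) ⊕ c = b`. [folklore] -/
@[simp] theorem bxor_bxor_cancel {ℓ : ℕ} (b c : Fin ℓ → Bool) : bxor (bxor b c) c = b := by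
  funext j
  simp [bxor]

/-- `z ⊕ a = z ⊕ b → a = b`. [folklore] -/
theorem bxor_right_cancel {ℓ : ℕ} {z a b : Fin ℓ → Bool} (h : bxor z a = bxor z b) : a = b := by
  funext j
  have h1 := congrFun h j
  simp only [bxor] at h1
  cases hz : z j <;> cases ha : a j <;> cases hb : b j <;> simp [hz, ha, hb] at h1 ⊢

/-- `w_{i,x}` is injective on the pairs handled at arity `ℓ`. [cite: AaronsonWigderson2008, Thm. 5.6 (proof: "a unique string")] -/
theorem code_injOn (e : ℕ → NPIdx) (ℓ : ℕ) :
    Set.InjOn (code ℓ) (Pairs e ℓ : Set (ℕ × List Bool)) := by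
  rintro ⟨i₁, x₁⟩ h₁ ⟨i₂, x₂⟩ h₂ h
  obtain ⟨h8, hi₁, hl₁, -⟩ := (mem_Pairs_iff e ℓ _).1 h₁
  obtain ⟨-, hi₂, hl₂, -⟩ := (mem_Pairs_iff e ℓ _).1 h₂
  simp only at hi₁ hl₁ hi₂ hl₂
  have hℓ : 2 * (ℓ / 8) ≤ ℓ := by omega
  have hx : x₁ = x₂ := by
    refine List.ext_getElem (hl₁.trans hl₂.symm) fun j hj₁ hj₂ => ?_
    have := congrFun h ⟨j, by omega⟩
    simpa [code, hj₁, hj₂] using this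
  subst hx
  have := congrFun h ⟨x₁.length + i₁, by omega⟩
  simp [code] at this
  rw [this]

/-! ### One stage -/

/-- **One stage of the construction of Thm. 5.6** at arity `ℓ`, from constraint points `Y₀`
(with `|Y₀| ≤ 16ˢ` if `ℓ = 8s` is a coding arity) respected by the world `W₀`: there are

* the halting configuration `c = (Y, W_T, Sat)` of the iterative forcing process (`Valid`,
  `Terminal`);
* a string `z` and a world `W` which agrees with `W_T` at every arity `≠ ℓ` and at every point
  of `Y`, and whose slice at arity `ℓ` codes the satisfied pairs:
  `A_ℓ(z ⊕ w_{i,x}) = [⟨i, x⟩ ∈ Sat]` for every handled pair.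

Proof as printed: Lemma 4.5 at arity `ℓ` for the points of `Y` gives `≤ |Y|` bad Boolean points
`B`; since `|Pairs| · |B| < 2^ℓ` some `z` has `z ⊕ w_{i,x} ∉ B` for all pairs (the union bound);
the new slice is the old one changed at the good points `z ⊕ w_{i,x}` only, so Lemma 4.5 supplies
multiquadratic extensions over every `𝔽_p` with the old values on `Y`.
[cite: AaronsonWigderson2008, Thm. 5.6 (proof, pp. 26–27) and Lemma 4.5] -/
theorem exists_stage (e : ℕ → NPIdx) (ℓ : ℕ) (Y₀ : Finset Point) (W₀ : World)
    (hY₀ : 8 ∣ ℓ → Y₀.card ≤ 16 ^ (ℓ / 8)) :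
    ∃ (c : Config) (z : Fin ℓ → Bool) (W : World), Valid e ℓ Y₀ W₀ c ∧ Terminal e ℓ c ∧
      (∀ m, m ≠ ℓ → W.A m = c.W.A m) ∧
      (∀ (p : Nat.Primes) (m : ℕ), m ≠ ℓ → W.E.poly p m = c.W.E.poly p m) ∧
      (∀ pt ∈ c.Y, val W.E pt = val c.W.E pt) ∧
      ∀ pr ∈ Pairs e ℓ, W.A ℓ (bxor z (code ℓ pr)) = decide (pr ∈ c.Sat) := by
  classical
  obtain ⟨c, hvalid, hterm⟩ := exists_terminal e ℓ Y₀ W₀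
  -- Lemma 4.5 at arity `ℓ` for the points of `c.Y` of arity `ℓ`
  let Yℓ : Finset (APoint ℓ) := c.Y.preimage (Sigma.mk ℓ) sigma_mk_injective.injOn
  have hYℓ : ∀ y : APoint ℓ, y ∈ Yℓ ↔ (⟨ℓ, y⟩ : Point) ∈ c.Y := fun y => by simp [Yℓ]
  obtain ⟨B, hBcard, hB⟩ :=
    exists_free (c.W.A ℓ) (fun p => c.W.E.poly p ℓ) (fun p => c.W.ok p ℓ) Yℓ
  -- counting: `|Pairs| · |B| < 2 ^ ℓ`
  set s := ℓ / 8 with hs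
  have hBY : B.card ≤ c.Y.card := by
    refine hBcard.trans ?_
    calc Yℓ.card = (Yℓ.map ⟨Sigma.mk ℓ, sigma_mk_injective⟩).card := (card_map _).symm
      _ ≤ c.Y.card := card_le_card fun pt hpt => by
          obtain ⟨y, hy, rfl⟩ := mem_map.1 hpt
          exact (hYℓ y).1 hy
  have hcY : c.Y.card ≤ Y₀.card + (Pairs e ℓ).card * 2 ^ s :=
    hvalid.2.2.2.1.trans (Nat.add_le_add_left (Nat.mul_le_mul_right _ (card_le_card hvalid.2.2.1)) _)
  have hcount : (Pairs e ℓ).card * B.card < 2 ^ ℓ := by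
    by_cases h8 : 8 ∣ ℓ
    · have hP : (Pairs e ℓ).card ≤ s * 2 ^ s := card_Pairs_le e ℓ
      have h16 : Y₀.card ≤ 16 ^ s := hY₀ h8
      have hsl : 8 * s ≤ ℓ := Nat.mul_div_le ℓ 8
      rcases Nat.eq_zero_or_pos s with hs0 | hspos
      · rw [hs0] at hP
        simp only [zero_mul, nonpos_iff_eq_zero, card_eq_zero] at hP
        simp [hP]
      · have h2s : s ≤ 2 ^ s := (Nat.lt_two_pow_self).le
        -- `|Pairs| ≤ 4^s`, `|B| ≤ |c.Y| ≤ 16^s + 8^s`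
        have hP4 : (Pairs e ℓ).card ≤ 4 ^ s := by
          calc (Pairs e ℓ).card ≤ s * 2 ^ s := hP
            _ ≤ 2 ^ s * 2 ^ s := Nat.mul_le_mul_right _ h2s
            _ = 4 ^ s := by rw [← mul_pow]; norm_num
        have hB' : B.card ≤ 16 ^ s + 8 ^ s := by
          refine hBY.trans (hcY.trans ?_)
          refine Nat.add_le_add h16 ?_
          calc (Pairs e ℓ).card * 2 ^ s ≤ 4 ^ s * 2 ^ s := Nat.mul_le_mul_right _ hP4
            _ = 8 ^ s := by rw [← mul_pow]; norm_num
        have h4 : 2 ≤ 4 ^ s :=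
          calc 2 ≤ 4 ^ 1 := by norm_num
            _ ≤ 4 ^ s := Nat.pow_le_pow_right (by norm_num) hspos
        calc (Pairs e ℓ).card * B.card ≤ 4 ^ s * (16 ^ s + 8 ^ s) := Nat.mul_le_mul hP4 hB'
          _ = 64 ^ s + 32 ^ s := by rw [mul_add, ← mul_pow, ← mul_pow]; norm_num
          _ < 64 ^ s + 64 ^ s := Nat.add_lt_add_left (Nat.pow_lt_pow_left (by norm_num) hspos.ne') _
          _ = 2 * 64 ^ s := by ring
          _ ≤ 4 ^ s * 64 ^ s := Nat.mul_le_mul_right _ h4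
          _ = 2 ^ (8 * s) := by rw [← mul_pow, pow_mul]; norm_num
          _ ≤ 2 ^ ℓ := Nat.pow_le_pow_right (by norm_num) hsl
    · simp [Pairs, h8]
  -- the union bound: some `z` avoids `B` after every shift `w_{i,x}`
  let blocked : Finset (Fin ℓ → Bool) :=
    (Pairs e ℓ).biUnion fun pr => B.image fun b => bxor b (code ℓ pr)
  have hblocked : blocked.card < (univ : Finset (Fin ℓ → Bool)).card := by
    rw [card_univ, Fintype.card_fun, Fintype.card_bool, Fintype.card_fin]
    refine lt_of_le_of_lt ?_ hcount
    refine card_biUnion_le.trans ?_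
    exact (sum_le_card_nsmul _ _ _ fun pr _ => card_image_le).trans (by rw [smul_eq_mul])
  obtain ⟨z, -, hz⟩ := exists_mem_notMem_of_card_lt_card hblocked
  have hgood : ∀ pr ∈ Pairs e ℓ, bxor z (code ℓ pr) ∉ B := by
    intro pr hpr hmem
    exact hz (mem_biUnion.2 ⟨pr, hpr, mem_image.2 ⟨_, hmem, bxor_bxor_cancel z _⟩⟩)
  -- the new slice
  let f' : (Fin ℓ → Bool) → Bool := fun u =>
    if h : ∃ pr ∈ Pairs e ℓ, u = bxor z (code ℓ pr) then decide (h.choose ∈ c.Sat) else c.W.A ℓ u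
  have hf'B : ∀ u ∈ B, f' u = c.W.A ℓ u := by
    intro u hu
    have : ¬ ∃ pr ∈ Pairs e ℓ, u = bxor z (code ℓ pr) := by
      rintro ⟨pr, hpr, rfl⟩
      exact hgood pr hpr hu
    show (if h : ∃ pr ∈ Pairs e ℓ, u = bxor z (code ℓ pr) then decide (h.choose ∈ c.Sat)
      else c.W.A ℓ u) = c.W.A ℓ u
    rw [dif_neg this]
  have hf'code : ∀ pr ∈ Pairs e ℓ, f' (bxor z (code ℓ pr)) = decide (pr ∈ c.Sat) := by
    intro pr hpr
    have h : ∃ pr' ∈ Pairs e ℓ, bxor z (code ℓ pr) = bxor z (code ℓ pr') := ⟨pr, hpr, rfl⟩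
    have h1 : f' (bxor z (code ℓ pr)) = decide (h.choose ∈ c.Sat) := by
      show (if h : ∃ pr' ∈ Pairs e ℓ, bxor z (code ℓ pr) = bxor z (code ℓ pr') then
        decide (h.choose ∈ c.Sat) else c.W.A ℓ (bxor z (code ℓ pr))) = decide (h.choose ∈ c.Sat)
      rw [dif_pos h]
    rw [h1]
    obtain ⟨hpr', heq⟩ := h.choose_spec
    have hcode : code ℓ h.choose = code ℓ pr := (bxor_right_cancel heq).symm
    rw [code_injOn e ℓ hpr' hpr hcode]
  obtain ⟨P', hP', hP'Y⟩ := hB f' hf'B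
  refine ⟨c, z, c.W.update ℓ f' P' hP', hvalid, hterm, fun m hm => c.W.update_A_ne ℓ f' P' hP' hm,
    fun p m hm => c.W.update_poly_ne ℓ f' P' hP' p hm, fun pt hpt => ?_, fun pr hpr => ?_⟩
  · obtain ⟨m, y⟩ := pt
    by_cases hm : m = ℓ
    · subst hm
      simp only [val, World.update_poly_self]
      exact hP'Y y ((hYℓ y).2 hpt)
    · simp only [val, c.W.update_poly_ne ℓ f' P' hP' _ hm]
  · rw [World.update_A_self]
    exact hf'code pr hpr

/-! ### Barrier audit 2026-08-16 (D-0021): the forcing lemma is multiquadratic — it fails at multidegree 1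

Scope of the stage theorem, made explicit. Everything above (and the world of
`Algebrization_npLinearSize`, `IsExtensionOf A 2`) uses MULTIQUADRATIC extensions, through
`Multiquadratic.exists_free` (AW Lemma 4.5). This is not an artefact of the proof: at multidegree
`1` the lemma is false over every odd prime field. For a point all of whose coordinates are `½`,
every `δ_z` evaluates to `½ⁿ` (`eval_delta_half`), so the multilinear polynomial with Boolean
values `c` returns `½ⁿ · Σ_z c_z` there (`eval_mlin_half`; AW §1.4 p. 7, after
Juma–Kabanets–Rackoff–Shpilka: "we can evaluate the sum `Σ_x A(x)` with just a single query to
`Ã`, by using the fact that `Σ_x A(x) = 2ⁿ Ã(½, …, ½)` … This observation helps to explain why, in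
Section 4, we will often need to resort to multiquadratic extensions instead of multilinear
ones"; p. 19: "multidegree 2 is essential here"). Since a multilinear polynomial is determined by
its values on the cube (`eq_of_degreeOf_le_one`, from Mathlib's combinatorial Nullstellensatz),
EVERY multidegree-`1` extension of `f` over `𝔽_p`, `p` odd, takes the value `½ⁿ · |f⁻¹(1)|` at
`(½, …, ½)` (`eval_half_of_degreeOf_le_one`); toggling any one Boolean point changes it
(`degreeOne_not_free`), so below the single constraint point `(½, …, ½)` NO Boolean point is
free, and the statement of `exists_free` with `IsMQExt` replaced by its degree-`1` analogue is
false (`not_exists_free_degreeOne`, witness `n = 1`, `p = 3`).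

Consequences recorded for the catalogue entry (`Algebrization.lean`, blocks `Algebrization` /
`AlgebrizationNarrow`, fact `Algebrization_npLinearSize`), no statement there being changed:
(1) what those blocks claim is correct — AW Def. 2.3 quantifies over extensions of ANY constant
multidegree (Def. 2.2 (ii), p. 8; tree: `IsAlgebrizingSeparation … ∀ d`), and one degree-`2` world
refutes such a universally quantified conclusion; (2) the degree-`1` analogue
`∃ A Ã, Ã.IsExtensionOf A 1 ∧ NP^Ã ⊆ ⋃ c, SIZE^A(c·n + c)` of `Algebrization_npLinearSize` is NOT
established by this construction, nor in print over fields of odd characteristic: AW §1.3 p. 6 —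
"we do not know how to use communication complexity [their multilinear-yielding method,
Thm. 5.11: `NP^A ⊄ BPP^Ã` etc. with `Ã` multilinear, p. 28] to construct `A, Ã` such that
`NEXP^Ã ⊂ P^A/poly` and `NP^Ã ⊂ SIZE^A(n)`"; in characteristic `2` it IS established:
Aydınlıoğlu–Bach's interpolation lemma for affine (= multilinear over `GF(2ᵏ)`) extensions, whose
extension map is `𝔽₂`-linear (Lemma 33, Thm. 34), gives `f` with `NE^{f̃} ⊂ SIZE^f(n^d)` for a
constant `d`, so "`NEXP ⊄ P/poly`, in fact `NEXP ⊄ SIZE(n^d) ∀ d`" has no affinely relativizing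
proof (Thm. 35; polynomial rather than linear size). Hence, for the summit `PneNP`: conclusions
of the shape `NP ⊄ P/poly` remain blocked at multidegree `1` by the Thm. 5.1 world
(`AlgebrizationNarrow`, `NP^Ã ⊆ P^A ⊆ P^A/poly` with `Ã` multilinear), whereas for superlinear /
fixed-polynomial size bounds for `NP` (`NP ⊄ SIZE(n^k)`, `k` fixed) the catalogue's only world is
the degree-`2` world of Thm. 5.6 — in a world of the Thm. 5.1 kind such bounds even hold
(`NP^A ⊆ NP^Ã ⊆ P^A` gives `PH^A = P^A ⊆ NP^Ã`, and `Σ₂^A ⊄ SIZE^A(n^k)` by Kannan's relativizing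
argument; not formalised here); so arguments that hold relative to every `(A, Ã)` with `Ã`
MULTILINEAR over the prime fields only are outside what is established here. -/

section DegreeOne

/-- At a point all of whose coordinates equal `h` with `2h = 1` ("one half") every basis
polynomial `δ_z` takes the value `hⁿ`: each factor `xᵢ` or `1 - xᵢ` evaluates to `h`.
[cite: AaronsonWigderson2008, §1.4 p. 7] -/
theorem eval_delta_half {F : Type*} [CommRing F] {n : ℕ} {h : F} (hh : 2 * h = 1)
    (z : Fin n → Bool) : eval (fun _ => h) (delta z : MvPolynomial (Fin n) F) = h ^ n := by
  classical
  have h1 : (1 : F) - h = h := by linear_combination (-1 : F) * hh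
  have hfac : ∀ i, eval (fun _ => h) (if z i then X i else 1 - X i : MvPolynomial (Fin n) F) = h := by
    intro i
    cases z i <;> simp [h1]
  simp only [delta, map_prod, hfac, prod_const, card_univ, Fintype.card_fin]

/-- **One query computes the sum** (Juma–Kabanets–Rackoff–Shpilka; AW §1.4 p. 7:
"`Σ_{x ∈ {0,1}ⁿ} A(x) = 2ⁿ Ã(½, …, ½)`"): the multilinear polynomial with Boolean values `c`
returns `hⁿ · Σ_z c_z` at the point `(h, …, h)`, `2h = 1`. [cite: AaronsonWigderson2008, §1.4 p. 7] -/
theorem eval_mlin_half {F : Type*} [CommRing F] {n : ℕ} {h : F} (hh : 2 * h = 1)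
    (c : (Fin n → Bool) → F) : eval (fun _ => h) (mlin c) = h ^ n * ∑ z, c z := by
  classical
  simp only [mlin, map_sum, map_mul, eval_C, eval_delta_half hh, mul_sum]
  exact sum_congr rfl fun z _ => mul_comm _ _

/-- **Uniqueness of multilinear extensions** over an integral domain: two polynomials of degree
`≤ 1` in each variable that agree on the Boolean cube are equal (AW §4.1 p. 18: "we can write `m`
uniquely in the basis of `δ_z`'s"; here from Mathlib's combinatorial Nullstellensatz
`MvPolynomial.eq_zero_of_eval_zero_at_prod_finset` with the grid `{0,1}ⁿ`).
[cite: AaronsonWigderson2008, §4.1 p. 18] -/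
theorem eq_of_degreeOf_le_one {K : Type*} [CommRing K] [IsDomain K] {n : ℕ}
    {P Q : MvPolynomial (Fin n) K} (hP : ∀ i, P.degreeOf i ≤ 1) (hQ : ∀ i, Q.degreeOf i ≤ 1)
    (h : ∀ w : Fin n → Bool, eval (boolPt w) P = eval (boolPt w) Q) : P = Q := by
  classical
  have hsub : P - Q = 0 := by
    refine eq_zero_of_eval_zero_at_prod_finset (P - Q) (fun _ => ({0, 1} : Finset K)) (fun i => ?_) ?_
    · rw [card_pair (zero_ne_one (α := K))]
      exact Nat.lt_succ_of_le ((degreeOf_sub_le i _ _).trans (max_le (hP i) (hQ i)))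
    · intro x hx
      have hxw : x = boolPt (fun i => decide (x i = 1)) := by
        funext i
        rcases mem_insert.1 (hx i) with h0 | h1
        · have : x i ≠ 1 := by rw [h0]; exact zero_ne_one
          simp [boolPt, h0]
        · rw [mem_singleton] at h1
          simp [boolPt, h1]
      rw [map_sub, hxw, h, sub_self]
  exact sub_eq_zero.1 hsub

/-- `2 · 2⁻¹ = 1` in `𝔽_p` for an odd prime `p` ("over any field of characteristic other than 2",
AW p. 7). [folklore] -/
theorem two_mul_inv_two (p : Nat.Primes) (hp : (p : ℕ) ≠ 2) :
    (2 : ZMod p) * (2 : ZMod p)⁻¹ = 1 := by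
  haveI : Fact (p : ℕ).Prime := ⟨p.2⟩
  refine mul_inv_cancel₀ fun h2 => hp ?_
  have h2' : ((2 : ℕ) : ZMod p) = 0 := by exact_mod_cast h2
  rw [ZMod.natCast_eq_zero_iff] at h2'
  exact (Nat.prime_dvd_prime_iff_eq p.2 Nat.prime_two).1 h2'

/-- **Every multilinear extension leaks the count.** For an odd prime `p`, ANY polynomial over
`𝔽_p` of degree `≤ 1` in each variable extending the Boolean function `f` takes the value
`½ⁿ · |f⁻¹(1)|` at `(½, …, ½)` (uniqueness + `eval_mlin_half`). [cite: AaronsonWigderson2008, §1.4 p. 7 and remark after Thm. 4.4, p. 19] -/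
theorem eval_half_of_degreeOf_le_one (p : Nat.Primes) (hp : (p : ℕ) ≠ 2) {n : ℕ}
    (f : (Fin n → Bool) → Bool) (P : MvPolynomial (Fin n) (ZMod p))
    (hdeg : ∀ i, P.degreeOf i ≤ 1) (hval : ∀ w, eval (boolPt w) P = if f w then 1 else 0) :
    eval (fun _ => (2 : ZMod p)⁻¹) P =
      (2 : ZMod p)⁻¹ ^ n * ∑ z, (if f z then (1 : ZMod p) else 0) := by
  haveI : Fact (p : ℕ).Prime := ⟨p.2⟩
  have hPm : P = mlin fun z => if f z then (1 : ZMod p) else 0 :=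
    eq_of_degreeOf_le_one hdeg (degreeOf_mlin_le _) fun w => by rw [hval w, eval_mlin_boolPt]
  rw [hPm, eval_mlin_half (two_mul_inv_two p hp)]

/-- **No Boolean point is free below the single constraint point `(½, …, ½)`** (`p` odd): for
every set `B` of Boolean points other than the whole cube there is an `f'` agreeing with `f` on
`B` (namely `f` with one point outside `B` toggled) such that NO multidegree-`1` extension of `f'`
has the old value at `(½, …, ½)` — the count changed by `±1 ≢ 0 (mod p)`. Contrast AW Lemma 4.5
(`Multiquadratic.exists_free`): with multidegree `2`, all points outside a set of size `≤ |Y|`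
are free. [cite: AaronsonWigderson2008, remark after Thm. 4.4 (p. 19) and Lemma 4.5] -/
theorem degreeOne_not_free (p : Nat.Primes) (hp : (p : ℕ) ≠ 2) {n : ℕ}
    (f : (Fin n → Bool) → Bool) (P : MvPolynomial (Fin n) (ZMod p))
    (hdeg : ∀ i, P.degreeOf i ≤ 1) (hval : ∀ w, eval (boolPt w) P = if f w then 1 else 0)
    (B : Finset (Fin n → Bool)) (hB : B ≠ univ) :
    ∃ f' : (Fin n → Bool) → Bool, (∀ z ∈ B, f' z = f z) ∧
      ∀ P' : MvPolynomial (Fin n) (ZMod p), (∀ i, P'.degreeOf i ≤ 1) →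
        (∀ w, eval (boolPt w) P' = if f' w then 1 else 0) →
          eval (fun _ => (2 : ZMod p)⁻¹) P' ≠ eval (fun _ => (2 : ZMod p)⁻¹) P := by
  classical
  haveI : Fact (p : ℕ).Prime := ⟨p.2⟩
  obtain ⟨z, hz⟩ : ∃ z, z ∉ B := by
    by_contra hcon
    exact hB (eq_univ_iff_forall.2 fun w => not_not.1 fun hw => hcon ⟨w, hw⟩)
  refine ⟨Function.update f z (!f z), fun w hw => ?_, fun P' hdeg' hval' heq => ?_⟩
  · have : w ≠ z := fun h => hz (h ▸ hw)
    simp [Function.update_of_ne this]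
  rw [eval_half_of_degreeOf_le_one p hp _ P' hdeg' hval',
    eval_half_of_degreeOf_le_one p hp f P hdeg hval] at heq
  have hunit : ((2 : ZMod p)⁻¹ ^ n) ≠ 0 :=
    pow_ne_zero _ (inv_ne_zero (fun h2 => by simpa [h2] using two_mul_inv_two p hp))
  have hsum := mul_left_cancel₀ hunit heq
  -- isolate the term at `z`
  let χ : Bool → ZMod p := fun b => if b then 1 else 0
  have hupd : (fun w => χ (Function.update f z (!f z) w)) =
      Function.update (fun w => χ (f w)) z (χ (!f z)) := by
    funext w
    by_cases hw : w = z
    · subst hw; simp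
    · simp [Function.update_of_ne hw]
  have h1 : ∑ w, χ (Function.update f z (!f z) w) = χ (!f z) + ∑ w ∈ univ.erase z, χ (f w) := by
    rw [show (∑ w, χ (Function.update f z (!f z) w)) =
        ∑ w, Function.update (fun w => χ (f w)) z (χ (!f z)) w from by rw [hupd],
      sum_update_of_mem (mem_univ z), sdiff_singleton_eq_erase]
  have h2 : ∑ w, χ (f w) = χ (f z) + ∑ w ∈ univ.erase z, χ (f w) :=
    (add_sum_erase _ _ (mem_univ z)).symm
  change ∑ w, χ (Function.update f z (!f z) w) = ∑ w, χ (f w) at hsum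
  rw [h1, h2, add_left_inj] at hsum
  cases hfz : f z <;> simp [χ, hfz] at hsum

/-- **AW Lemma 4.5 is false at multidegree 1.** The statement of `Multiquadratic.exists_free`
(AW Lemma 4.5 over all prime fields) with "multiquadratic" (`IsMQExt`: `degreeOf ≤ 2`) replaced by
"multilinear" (`degreeOf ≤ 1`) fails: witness `n = 1`, `f ≡ 0`, `P ≡ 0`, the single constraint
point `(3, ½) ` (`½ = 2 ∈ 𝔽₃`), where a set `B` with `|B| ≤ |Y| = 1` misses a Boolean point
(`degreeOne_not_free`). This is the precise sense of AW's "multidegree 2 is essential here"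
(p. 19) for the forcing construction of Thm. 5.6: the stage theorem `exists_stage`, and with it
the tree's world for `Algebrization_npLinearSize`, is inherently a multidegree-`2` world; a
degree-`1` world for the `NP`-circuit line is known in characteristic `2` only (Aydınlıoğlu–Bach,
Thm. 35, where the extension map is `𝔽₂`-linear, Lemma 33).
[cite: AaronsonWigderson2008, remark after Thm. 4.4 (p. 19), Lemma 4.5, §1.3 p. 6] [cite: AydinliogluBach2018, §4.1 Lemma 33 and Thm. 35] -/
theorem not_exists_free_degreeOne :
    ¬ ∀ (n : ℕ) (f : (Fin n → Bool) → Bool) (P : ∀ p : Nat.Primes, MvPolynomial (Fin n) (ZMod p)),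
      (∀ p, (∀ i, (P p).degreeOf i ≤ 1) ∧ ∀ w, eval (boolPt w) (P p) = if f w then 1 else 0) →
      ∀ Y : Finset (Σ p : Nat.Primes, (Fin n → ZMod p)),
        ∃ B : Finset (Fin n → Bool), B.card ≤ Y.card ∧
          ∀ f' : (Fin n → Bool) → Bool, (∀ z ∈ B, f' z = f z) →
            ∃ P' : ∀ p : Nat.Primes, MvPolynomial (Fin n) (ZMod p),
              (∀ p, (∀ i, (P' p).degreeOf i ≤ 1) ∧ ∀ w, eval (boolPt w) (P' p) = if f' w then 1 else 0) ∧
                ∀ y ∈ Y, eval y.2 (P' y.1) = eval y.2 (P y.1) := by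
  classical
  intro h
  let p3 : Nat.Primes := ⟨3, Nat.prime_three⟩
  have hp3 : ((p3 : ℕ)) ≠ 2 := by decide
  let pt : Σ p : Nat.Primes, (Fin 1 → ZMod p) := ⟨p3, fun _ => (2 : ZMod p3)⁻¹⟩
  have hP0 : ∀ p : Nat.Primes, (∀ i, (0 : MvPolynomial (Fin 1) (ZMod p)).degreeOf i ≤ 1) ∧
      ∀ w : Fin 1 → Bool, eval (boolPt w) (0 : MvPolynomial (Fin 1) (ZMod p)) =
        if (fun _ : Fin 1 → Bool => false) w then 1 else 0 := fun p =>
    ⟨fun i => by simp, fun w => by simp⟩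
  obtain ⟨B, hBcard, hB⟩ := h 1 (fun _ => false) (fun _ => 0) hP0 {pt}
  have hBne : B ≠ univ := by
    intro hBu
    rw [hBu, card_singleton, card_univ, Fintype.card_fun, Fintype.card_bool, Fintype.card_fin] at hBcard
    omega
  obtain ⟨f', hf'B, hne⟩ :=
    degreeOne_not_free p3 hp3 (fun _ => false) (0 : MvPolynomial (Fin 1) (ZMod p3))
      (hP0 p3).1 (hP0 p3).2 B hBne
  obtain ⟨P', hP', hY⟩ := hB f' hf'B
  exact hne (P' p3) (hP' p3).1 (hP' p3).2 (hY pt (mem_singleton_self pt))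

end DegreeOne

end AW56

end Literature.Barriers.PneNP
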